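import Literature.AnabelianGeometry.EtaleTheta.FrobenioidThetaDivisorSupportQOrders
import Literature.AnabelianGeometry.EtaleTheta.Discharge.Sec5Prop53ChainModel
import Literature.AnabelianGeometry.EtaleTheta.Discharge.Sec5Prop53PerfectVacuity
import Literature.AlgebraicGeometry.Frobenioids.PiMonoprimePerfFactorial
import Literature.AlgebraicGeometry.Frobenioids.PerfectionPrimes

/-!
# [EtTh] §5, Proposition 5.3: the perfect-`Φ` divisor-support vocabulary `Q` is INHABITED at a §5 datum with PERFECT `Φ(A_⊚)`
(non-vacuity certificate for `DivisorSupportDataQ` + the binder `PrincipalIffIntegralDegreeZero`; the PRODUCT chain model)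

Mochizuki, *The étale theta function …*, Publ. RIMS **45** (2009)
[cite: MochizukiEtTh2009, Prop 5.3 p.325–327 (PDF pp.99–101); Prop 3.2 (i) p.296 (PDF p.70); Prop 5.1 p.323 (PDF p.97); §1 p.238–240 (PDF pp.12–14); Prop 1.4 (i) p.247 (PDF p.21)].
Seat abc-iut-L6-d1 (gen 4).  TOY DATA + proofs (no `Prop` fact): the PRODUCT twin of abc-iut-f-128's chain model
(`Discharge/Sec5Prop53ChainModel.lean`: `C = D = SingleObj ℤ`, `Aut_C(A_⊚) ≅ ℤ` translating the chain; reused BY NAME: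
`TZ`, `pt`, `rhoChain`, `affine`, `chainAut`, `shift`, f-009's `Idx = ℤ ⊔ ℤ`, `Fac _ = ℚ_{≥0}`, `fac_monoprime`) with the
divisor monoid the FULL PRODUCT `Φ(A_⊚) := ∏_{ℤ ⊔ ℤ} ℚ_{≥0}` (Prop. 3.2 (i) p.296 (PDF p.70): "a direct product of copies
of `ℚ_{≥0}`, indexed by the cusps … and irreducible components") instead of the direct sum — a PERFECT monoid
(`isPerfect_phiAcirc`), as Prop. 5.1 demands, whose primes are the coordinates (abc-iut-w4-d084's
`Frobenioids/PiMonoprimePerfFactorial.lean`).  The product is forced by F5: `div(Θ̈)` has order `1` at EVERY cusp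
(Prop. 1.4 (i)), an element of infinite support.

WHAT IS PROVED.
* `isEmpty_divisorSupportData'_prod` — at this datum the repair of record `DivisorSupportData'` (the `ℤ`-reading) is
  EMPTY (abc-iut-f-127's `isEmpty_divisorSupportData'_of_isPerfect`);
* `supportDataQ` / `principalIffIntegralDegreeZero_supportDataQ` / `exists_divisorSupportDataQ` — the perfect-`Φ` repair
  `DivisorSupportDataQ` (p441752) IS inhabited there, TOGETHER with its binder: coordinates = the `ℚ_{≥0}`-valued
  components, `gen 𝔭` = the indicator of the coordinate of `𝔭`, primary elements = single-coordinate elements of positive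
  value (`factor_carrier`), the sup-characterisation `le_ord_iff`, the canonical component isomorphisms pinned by the
  indicators (`ncspIso_gen`/`cspIso_gen`), `div(Θ̈)` of order `1` at every cusp (F5), every translation realised (F6), and
  F1 `principal` := the lattice of INTEGRAL elements of degree `0` on every component — for which the binder holds by
  construction (the toy's "Picard group of the chain by degrees", §1 p.240).
So every hypothesis-free consequence of the `Q` files is non-vacuous at a perfect-`Φ` datum; the `ℤ`-reading is not.
HONEST FRAMING: a toy datum says nothing about the tempered Frobenioid of [EtTh] §5 or the truth of Prop. 5.3 there, and
nothing about [IUTchIII] Cor. 3.12; no side is taken; typed ≠ proved; non-vacuity ≠ discharge. -/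

noncomputable section

namespace Literature.AnabelianGeometry.EtaleTheta.FrobenioidThetaDivisors.QProdChain

open CategoryTheory Literature.AlgebraicGeometry.Frobenioids ConstantMultiple ConstantMultiple.Cor512Toy Prop53Toy
  Prop53Chain

/-! ### The full product `∏_{ℤ ⊔ ℤ} ℚ_{≥0}` and its primes -/

/-- `Φ(A_⊚) := ∏_{ℤ ⊔ ℤ} ℚ_{≥0}`, the FULL product (Prop. 3.2 (i): "a direct product of copies of `ℚ_{≥0}`").
[cite: MochizukiEtTh2009, Prop 3.2 (i) p.296 (PDF p.70)] -/
abbrev Φp : Type := ∀ i : Idx, Fac i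

/-- `idx 𝔭 ∈ ℤ ⊔ ℤ`, the coordinate of a prime of `∏ ℚ_{≥0}` (`PiMonoprime.idx`). [cite: MochizukiFrdI2008, §0 p.12] -/
abbrev idxP : Primes Φp → Idx := PiMonoprime.idx fac_monoprime

/-- `P_i`, the prime of the coordinate `i` (`PiMonoprime.primeOf`). [cite: MochizukiFrdI2008, §0 p.12] -/
abbrev Pp (i : Idx) : Primes Φp := PiMonoprime.primeOf fac_monoprime i

/-- `idx (P i) = i`. [cite: MochizukiFrdI2008, §0 p.12] -/
theorem idxP_Pp (i : Idx) : idxP (Pp i) = i := PiMonoprime.idx_primeOf fac_monoprime i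

/-- `P (idx 𝔭) = 𝔭`. [cite: MochizukiFrdI2008, §0 p.12] -/
theorem Pp_idxP (𝔭 : Primes Φp) : Pp (idxP 𝔭) = 𝔭 := PiMonoprime.primeOf_idx fac_monoprime 𝔭

/-- `idx` is injective (`Prime(∏ ℚ_{≥0}) ≃ ℤ ⊔ ℤ`). [cite: MochizukiFrdI2008, §0 p.12] -/
theorem idxP_injective : Function.Injective idxP := (PiMonoprime.primesEquiv fac_monoprime).injective

/-- Re-indexing along `σ`: `(e f)_j := f_{σ⁻¹ j}` (no support condition in the full product).
[cite: MochizukiEtTh2009, Prop 5.3 p.325 (PDF p.99)] -/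
def reindexP (σ : Idx ≃ Idx) : Φp ≃* Φp where
  toFun f j := f (σ.symm j)
  invFun f j := f (σ j)
  left_inv f := funext fun j => congrArg f (σ.symm_apply_apply j)
  right_inv f := funext fun j => congrArg f (σ.apply_symm_apply j)
  map_mul' _ _ := rfl

/-- Components of `reindexP`. [cite: MochizukiEtTh2009, Prop 5.3 p.325 (PDF p.99)] -/
@[simp] theorem reindexP_apply (σ : Idx ≃ Idx) (f : Φp) (j : Idx) : reindexP σ f j = f (σ.symm j) := rfl

/-- `reindexP σ (mulSingle i a) = mulSingle (σ i) a`. [cite: MochizukiEtTh2009, Prop 5.3 p.325 (PDF p.99)] -/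
theorem reindexP_mulSingle (σ : Idx ≃ Idx) (i : Idx) (a : Multiplicative NNRat) :
    reindexP σ (Pi.mulSingle i a) = Pi.mulSingle (σ i) a := by
  funext j
  rw [reindexP_apply]
  by_cases h : j = σ i
  · subst h; rw [Equiv.symm_apply_apply, Pi.mulSingle_eq_same, Pi.mulSingle_eq_same]
  · rw [Pi.mulSingle_eq_of_ne h, Pi.mulSingle_eq_of_ne]
    intro h'; exact h ((Equiv.symm_apply_eq σ).mp h')

/-- Translating by `0` is the identity. [cite: MochizukiEtTh2009, Prop 5.3 p.325 (PDF p.99)] -/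
theorem reindexP_shift_zero (f : Φp) : reindexP (shift 0) f = f :=
  funext fun j => congrArg f (show (shift 0).symm j = j by rcases j with n | n <;> simp)

/-- Translating by `a + b` is translating by `a`, then by `b`. [cite: MochizukiEtTh2009, Prop 5.3 p.325 (PDF p.99)] -/
theorem reindexP_shift_add (a b : ℤ) (f : Φp) :
    reindexP (shift (a + b)) f = reindexP (shift b) (reindexP (shift a) f) :=
  funext fun j => congrArg f
    (show (shift (a + b)).symm j = (shift a).symm ((shift b).symm j) by rcases j with n | n <;> simp <;> ring)

/-- `reindexP σ` carries `P i` to `P (σ i)`. [cite: MochizukiFrdI2008, §0 p.12] -/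
theorem congr_reindexP_Pp (σ : Idx ≃ Idx) (i : Idx) : Primes.congr (reindexP σ) (Pp i) = Pp (σ i) := by
  have hone : (Multiplicative.ofAdd (1 : NNRat)) ≠ 1 := by
    rw [Ne, ← ofAdd_zero, Multiplicative.ofAdd.injective.eq_iff]; exact one_ne_zero
  have hmem : ∀ k : Idx, (Pi.mulSingle k (Multiplicative.ofAdd (1 : NNRat)) : Φp) ∈ (Pp k).carrier := fun k =>
    (PiMonoprime.mem_carrier_primeOf_iff fac_monoprime k _).mpr (PiMonoprime.dsupp_mulSingle hone)
  have h₁ : reindexP σ (Pi.mulSingle i (Multiplicative.ofAdd (1 : NNRat))) ∈ (Primes.congr (reindexP σ) (Pp i)).carrier := by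
    rw [Primes.carrier_congr]; exact ⟨_, hmem i, rfl⟩
  rw [reindexP_mulSingle] at h₁
  exact primes_eq_of_mem_carrier h₁ (hmem (σ i))

/-- Hence `idx (e 𝔭) = σ (idx 𝔭)` for `e = reindexP σ`. [cite: MochizukiFrdI2008, §0 p.12] -/
theorem idxP_congr_reindexP (σ : Idx ≃ Idx) (𝔭 : Primes Φp) :
    idxP (Primes.congr (reindexP σ) 𝔭) = σ (idxP 𝔭) := by
  conv_lhs => rw [← Pp_idxP 𝔭]
  rw [congr_reindexP_Pp, idxP_Pp]

/-! ### The §5 datum: `C = D = SingleObj ℤ`, `Φ(⋆) = ∏_{ℤ ⊔ ℤ} ℚ_{≥0}` translated by `Aut(⋆) ≅ ℤ` -/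

/-- The product-chain pre-Frobenioid data (f-128's `chainPre` with the full product).
[cite: MochizukiEtTh2009, Prop 5.3 p.325 (PDF p.99)] -/
abbrev prodPre : PreFrobenioidData.{0} TZ TZ where
  base := 𝟭 TZ
  Mon := fun _ => Φp
  pull := fun k => (reindexP (shift (Multiplicative.toAdd k))).toMonoidHom
  pull_id := fun _ x => reindexP_shift_zero x
  pull_comp := fun β α x => reindexP_shift_add (Multiplicative.toAdd α) (Multiplicative.toAdd β) x
  div := fun _ => 1
  degFr := fun _ => 1
  div_id := fun _ => rfl
  div_comp := fun _ _ => by simp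
  degFr_id := fun _ => rfl
  degFr_comp := fun _ _ => rfl

/-- The product-chain `TemperedFrobenioidStub` (as f-128's). [cite: MochizukiEtTh2009, §5 p.322 (PDF p.96)] -/
abbrev prodStub : FrobenioidTheta.TemperedFrobenioidStub.{0} TZ TZ where
  pre := prodPre
  units_comm S := ⟨⟨fun a b => Subtype.ext <| Aut.ext <| by
    change b.1.hom ≫ a.1.hom = a.1.hom ≫ b.1.hom
    rw [SingleObj.comp_as_mul, SingleObj.comp_as_mul]
    exact @mul_comm (Multiplicative ℤ) _ a.1.hom b.1.hom⟩⟩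
  biratUnits := fun _ => Unit
  unitsToBirat := fun _ => 1
  unitsToBirat_injective S := by
    intro a b _
    apply Subtype.ext
    apply Aut.ext
    exact a.2.1.trans b.2.1.symm
  unitsPull := fun _ => 1
  IsBaseFrobeniusType := ⊤

/-- **The product-chain §5 datum** `prodTheta : ThetaFrobenioid (SingleObj ℤ) (SingleObj ℤ)` (f-128's `chainTheta` with
`Φ(−) := ∏_{ℤ ⊔ ℤ} ℚ_{≥0}`). [cite: MochizukiEtTh2009, Prop 5.3 p.325 (PDF p.99)] -/
abbrev prodTheta : ThetaFrobenioid.{0} TZ TZ where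
  toTemperedFrobenioidStub := prodStub
  lDelta := fun _ => Unit
  lDeltaMap := fun _ => MonoidHom.id Unit
  l := 1
  odd_l := odd_one
  N := 2
  Acirc := pt
  AN := pt
  BN := pt
  sCap := 𝟙 pt
  sCup := 𝟙 pt
  base_map_sCap := rfl
  isPreStep_sCap := ⟨rfl, by change IsIso (𝟙 _); infer_instance⟩
  isPreStep_sCup := ⟨rfl, by change IsIso (𝟙 _); infer_instance⟩
  PiX := Multiplicative ℤ × Mm
  zquot := MonoidHom.fst _ _
  zquot_surjective := fun z => ⟨(z, 1), rfl⟩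
  PiYdd := ⊥
  PiYdd_le := bot_le
  relindex_PiYdd := by rw [Subgroup.relIndex_bot_left, Nat.card_congr kerFstEquiv, Nat.card_zmod]
  PiYdd_normal := inferInstance
  isOpen_PiYdd := isOpen_discrete _
  ρ := rhoChain
  ρ_surjective := rhoChain_surjective
  isOpen_ker_ρ := isOpen_discrete _
  strv := 1
  sgpCap := 1
  sgpCup := 1
  K := ZMod 2
  constEmb := 1
  constEmb_injective := by
    intro a b _
    have h : ∀ u : (ZMod 2)ˣ, u = 1 := by decide
    rw [h a, h b]
  thetaFn := ()

/-- `Φ(A_⊚) = ∏_{ℤ ⊔ ℤ} ℚ_{≥0}` in the product-chain datum. [cite: MochizukiEtTh2009, Prop 3.2 (i) p.296 (PDF p.70)] -/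
theorem phiAcirc_eq : prodTheta.PhiAcirc = Φp := rfl

/-- **`Φ(A_⊚)` is PERFECT** (Prop. 5.1 "whose divisor monoid `Φ(−)` is perfect": a product of copies of `ℚ_{≥0}`).
[cite: MochizukiEtTh2009, Prop 5.1 p.323 (PDF p.97)] -/
theorem isPerfect_phiAcirc : IsPerfect prodTheta.PhiAcirc :=
  PiMonoprime.isPerfect fun _ => isPerfect_multiplicative_nnrat

/-- `Aut_C(A_⊚)` acts on `Φ(A_⊚)` by translating the chain. [cite: MochizukiEtTh2009, Prop 5.3 (vi) p.326 (PDF p.100)] -/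
theorem pullAut_prod (g : Aut prodTheta.Acirc) (a : Φp) :
    prodTheta.pullAut g a = reindexP (shift (Multiplicative.toAdd g.inv)) a := rfl

/-! ### Cuspidal / non-cuspidal primes, labels, canonical component isomorphisms, `div(Θ̈)` -/

/-- A prime of `∏ ℚ_{≥0}` is CUSPIDAL iff its coordinate is `inr n`. [cite: MochizukiEtTh2009, Prop 5.3 p.325 (PDF p.99)] -/
def IsCuspP (𝔭 : Primes Φp) : Prop := ∃ n : ℤ, idxP 𝔭 = Sum.inr n

/-- `P (inr n)` is cuspidal. [cite: MochizukiEtTh2009, Prop 5.3 p.325 (PDF p.99)] -/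
theorem isCuspP_inr (n : ℤ) : IsCuspP (Pp (Sum.inr n)) := ⟨n, idxP_Pp _⟩

/-- `P (inl n)` is not cuspidal. [cite: MochizukiEtTh2009, Prop 5.3 p.325 (PDF p.99)] -/
theorem not_isCuspP_inl (n : ℤ) : ¬ IsCuspP (Pp (Sum.inl n)) := by
  rintro ⟨m, hm⟩
  rw [idxP_Pp] at hm
  exact Sum.inl_ne_inr hm

/-- A non-cuspidal prime has coordinate `inl n`. [cite: MochizukiEtTh2009, Prop 5.3 p.325 (PDF p.99)] -/
theorem idxP_eq_inl_of_not_isCuspP {𝔭 : Primes Φp} (h : ¬ IsCuspP 𝔭) : ∃ n, idxP 𝔭 = Sum.inl n := by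
  rcases hi : idxP 𝔭 with n | n
  · exact ⟨n, rfl⟩
  · exact (h ⟨n, hi⟩).elim

/-- The label `inl n ↦ n`, `inr n ↦ n`. [cite: MochizukiEtTh2009, Prop 5.3 (v) p.325 (PDF p.99)] -/
def labelP (𝔭 : Primes Φp) : ℤ := Sum.elim id id (idxP 𝔭)

/-- `label (P (inl n)) = n`. [cite: MochizukiEtTh2009, Prop 5.3 (v) p.325 (PDF p.99)] -/
theorem labelP_inl (n : ℤ) : labelP (Pp (Sum.inl n)) = n := by simp [labelP, idxP_Pp]

/-- `label (P (inr n)) = n`. [cite: MochizukiEtTh2009, Prop 5.3 (v) p.325 (PDF p.99)] -/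
theorem labelP_inr (n : ℤ) : labelP (Pp (Sum.inr n)) = n := by simp [labelP, idxP_Pp]

/-- A non-cuspidal prime is `P (inl (label 𝔭))`. [cite: MochizukiEtTh2009, Prop 5.3 (v) p.325 (PDF p.99)] -/
theorem Pp_inl_labelP {𝔭 : Primes Φp} (h : ¬ IsCuspP 𝔭) : Pp (Sum.inl (labelP 𝔭)) = 𝔭 := by
  obtain ⟨n, hn⟩ := idxP_eq_inl_of_not_isCuspP h
  have : labelP 𝔭 = n := by simp [labelP, hn]
  rw [this, ← hn, Pp_idxP]

/-- A cuspidal prime is `P (inr (label 𝔭))`. [cite: MochizukiEtTh2009, Prop 5.3 p.325 (PDF p.99)] -/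
theorem Pp_inr_labelP {𝔭 : Primes Φp} (h : IsCuspP 𝔭) : Pp (Sum.inr (labelP 𝔭)) = 𝔭 := by
  obtain ⟨n, hn⟩ := h
  have : labelP 𝔭 = n := by simp [labelP, hn]
  rw [this, ← hn, Pp_idxP]

/-- The canonical isomorphism between two primary components of `∏ ℚ_{≥0}` (both `≅ ℚ_{≥0}` by evaluation at their
coordinate). [cite: MochizukiEtTh2009, Prop 5.3 (ii) p.325 (PDF p.99)] -/
def canonIsoP (𝔭 𝔮 : Primes Φp) : ↥𝔭.submonoid ≃* ↥𝔮.submonoid :=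
  (PiMonoprime.submonoidEquiv fac_monoprime 𝔭 (idxP 𝔭) (Pp_idxP 𝔭)).trans
    (PiMonoprime.submonoidEquiv fac_monoprime 𝔮 (idxP 𝔮) (Pp_idxP 𝔮)).symm

/-- `canonIsoP 𝔭 𝔮 x = x_{idx 𝔭} · [idx 𝔮]`. [cite: MochizukiEtTh2009, Prop 5.3 (ii) p.325 (PDF p.99)] -/
theorem canonIsoP_val (𝔭 𝔮 : Primes Φp) (x : ↥𝔭.submonoid) :
    ((canonIsoP 𝔭 𝔮 x : ↥𝔮.submonoid) : Φp) = Pi.mulSingle (idxP 𝔮) ((x : Φp) (idxP 𝔭)) := rfl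

/-- `div(Θ̈)`: order `1` at EVERY cusp, `0` on the components (Prop. 1.4 (i): "each zero has multiplicity 1"; an element of
INFINITE support — hence the full product).  [cite: MochizukiEtTh2009, Prop 1.4 (i) p.247 (PDF p.21)] -/
def divThetaP : Φp := fun i => Sum.elim (fun _ => (1 : Multiplicative NNRat)) (fun _ => Multiplicative.ofAdd 1) i

/-- **The prime data of the product-chain datum**: cuspidal primes = `inr`-coordinates, canonical component isomorphisms,
`Prime^csp ↠ Prime^ncsp : P (inr n) ↦ P (inl n)`, labels `P (inl n) ↦ n`, `div(Θ̈)` of order `1` at every cusp.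
[cite: MochizukiEtTh2009, Prop 5.3 p.325 (PDF p.99)] -/
def prodPrimeData : DivisorPrimeData prodTheta where
  IsCuspidalElt a := ∀ 𝔭 : Primes Φp, a ∈ 𝔭.carrier → IsCuspP 𝔭
  IsNonCuspidalElt a := ∀ 𝔭 : Primes Φp, a ∈ 𝔭.carrier → ¬ IsCuspP 𝔭
  IsCuspidal := IsCuspP
  isCuspidal_iff 𝔭 := by
    constructor
    · intro h a ha 𝔮 hq
      rwa [← primes_eq_of_mem_carrier ha hq]
    · intro h
      obtain ⟨a, ha⟩ := exists_mem_carrier 𝔭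
      exact h a ha 𝔭 ha
  ncspIso 𝔭 𝔮 _ _ := canonIsoP 𝔭 𝔮
  cspIso 𝔭 𝔮 _ _ := canonIsoP 𝔭 𝔮
  cspToNcsp 𝔭 := ⟨Pp (Sum.inl (labelP 𝔭.1)), not_isCuspP_inl _⟩
  cspToNcsp_surjective := by
    rintro ⟨𝔮, hq⟩
    refine ⟨⟨Pp (Sum.inr (labelP 𝔮)), isCuspP_inr _⟩, Subtype.ext ?_⟩
    change Pp (Sum.inl (labelP (Pp (Sum.inr (labelP 𝔮))))) = 𝔮
    rw [labelP_inr, Pp_inl_labelP hq]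
  ncspEquivZ :=
    { toFun := fun 𝔭 => labelP 𝔭.1
      invFun := fun n => ⟨Pp (Sum.inl n), not_isCuspP_inl n⟩
      left_inv := fun 𝔭 => Subtype.ext (Pp_inl_labelP 𝔭.2)
      right_inv := fun n => labelP_inl n }
  divTheta := Algebra.GrothendieckGroup.of divThetaP

/-- The cusp over the component `𝔫`: `P (inr (label 𝔫))` (one cusp per component in this toy).
[cite: MochizukiEtTh2009, Prop 5.3 p.325 (PDF p.99)] -/
def cuspOver (𝔫 : {p : Primes prodTheta.PhiAcirc // ¬ prodPrimeData.IsCuspidal p}) :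
    {p : Primes prodTheta.PhiAcirc // prodPrimeData.IsCuspidal p} :=
  ⟨Pp (Sum.inr (labelP 𝔫.1)), isCuspP_inr _⟩

/-- The fibre of `Prime^csp ↠ Prime^ncsp` over `𝔫` is `{cuspOver 𝔫}`. [cite: MochizukiEtTh2009, Prop 5.3 (iv) p.325 (PDF p.99)] -/
theorem fibre_eq_singleton (𝔫 : {p : Primes prodTheta.PhiAcirc // ¬ prodPrimeData.IsCuspidal p}) :
    {𝔠 : {p : Primes prodTheta.PhiAcirc // prodPrimeData.IsCuspidal p} | prodPrimeData.cspToNcsp 𝔠 = 𝔫} =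
      {cuspOver 𝔫} := by
  ext 𝔠
  simp only [Set.mem_setOf_eq, Set.mem_singleton_iff]
  constructor
  · intro h
    apply Subtype.ext
    have h1 : Pp (Sum.inl (labelP 𝔠.1)) = 𝔫.1 := congrArg Subtype.val h
    have h2 : labelP 𝔠.1 = labelP 𝔫.1 := by rw [← h1, labelP_inl]
    change 𝔠.1 = Pp (Sum.inr (labelP 𝔫.1))
    rw [← h2, Pp_inr_labelP 𝔠.2]
  · rintro rfl
    apply Subtype.ext
    change Pp (Sum.inl (labelP (Pp (Sum.inr (labelP 𝔫.1))))) = 𝔫.1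
    rw [labelP_inr, Pp_inl_labelP 𝔫.2]

/-! ### Coordinates -/

/-- The `i`-th coordinate `∏ ℚ_{≥0} → ℚ` (into the multiplicatively written additive group `ℚ`).
[cite: MochizukiEtTh2009, Prop 3.2 (i) p.296 (PDF p.70)] -/
def coordP (i : Idx) : Φp →* Multiplicative ℚ :=
  (AddMonoidHom.toMultiplicative (NNRat.coeHom : ℚ≥0 →+* ℚ).toAddMonoidHom).comp (Pi.evalMonoidHom Fac i)

/-- `coordP i a` is the `i`-th coordinate of `a`, cast to `ℚ`. [cite: MochizukiEtTh2009, Prop 3.2 (i) p.296 (PDF p.70)] -/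
theorem toAdd_coordP (i : Idx) (a : Φp) :
    Multiplicative.toAdd (coordP i a) = ((Multiplicative.toAdd (a i) : ℚ≥0) : ℚ) := rfl

/-- The factorization homomorphism `Φ(A_⊚) → ∏_𝔭 ℚ`: `a ↦ (a_{idx 𝔭})_𝔭`. [cite: MochizukiFrdI2008, Def. 2.4(i) p.47] -/
def factorP : Φp →* (Primes Φp → Multiplicative ℚ) where
  toFun a 𝔭 := coordP (idxP 𝔭) a
  map_one' := funext fun _ => map_one _
  map_mul' a b := funext fun _ => map_mul _ a b

/-- `factorP a 𝔭 = coordP (idx 𝔭) a`. [cite: MochizukiFrdI2008, Def. 2.4(i) p.47] -/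
@[simp] theorem factorP_apply (a : Φp) (𝔭 : Primes Φp) : factorP a 𝔭 = coordP (idxP 𝔭) a := rfl

/-- The prime log-divisor of `𝔭`: the indicator `1 · [idx 𝔭]`. [cite: MochizukiEtTh2009, Prop 5.3 p.325 (PDF p.99)] -/
def genP (𝔭 : Primes Φp) : Φp := Pi.mulSingle (idxP 𝔭) (Multiplicative.ofAdd 1)

/-- `ofAdd 1 ≠ 1` in multiplicative `ℚ_{≥0}`. [folklore] -/
private theorem q1_ne_one : (Multiplicative.ofAdd (1 : NNRat)) ≠ 1 := by
  rw [Ne, ← ofAdd_zero, Multiplicative.ofAdd.injective.eq_iff]; exact one_ne_zero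

/-- Divisibility in multiplicative `ℚ_{≥0}` is the order. [folklore] -/
private theorem mnnrat_dvd_iff (x y : Multiplicative NNRat) : x ∣ y ↔ Multiplicative.toAdd x ≤ Multiplicative.toAdd y := by
  constructor
  · rintro ⟨c, rfl⟩
    rw [toAdd_mul]; exact le_self_add
  · intro h
    obtain ⟨c, hc⟩ := exists_add_of_le h
    exact ⟨Multiplicative.ofAdd c, by
      apply Multiplicative.toAdd.injective; rw [toAdd_mul, toAdd_ofAdd]; exact hc⟩

/-! ### The perfect-`Φ` support data at the product-chain datum -/

/-- **STEP 1 of the two-step construction**: all fields of `DivisorSupportDataQ` EXCEPT F1 (taken `⊤` here, replaced in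
step 2).  [cite: MochizukiEtTh2009, Prop 5.3 p.325–326 (PDF pp.99–100)] -/
def supportDataQ₀ : DivisorSupportDataQ prodPrimeData where
  factor := factorP
  factor_injective := by
    intro a b h
    funext i
    have hi := congrFun h (Pp i)
    change coordP (idxP (Pp i)) a = coordP (idxP (Pp i)) b at hi
    rw [idxP_Pp] at hi
    have hi' : ((Multiplicative.toAdd ((a : Φp) i) : ℚ≥0) : ℚ) = ((Multiplicative.toAdd ((b : Φp) i) : ℚ≥0) : ℚ) :=
      congrArg Multiplicative.toAdd hi
    exact Multiplicative.toAdd.injective (NNRat.coe_injective hi')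
  factor_nonneg := fun a 𝔭 => by
    change (0 : ℚ) ≤ ((Multiplicative.toAdd ((a : Φp) (idxP 𝔭)) : ℚ≥0) : ℚ)
    exact NNRat.coe_nonneg _
  gen := genP
  factor_gen_self := fun 𝔭 => by
    change coordP (idxP 𝔭) (genP 𝔭) = Multiplicative.ofAdd 1
    apply Multiplicative.toAdd.injective
    rw [toAdd_coordP, genP, Pi.mulSingle_eq_same, toAdd_ofAdd, toAdd_ofAdd, NNRat.coe_one]
  factor_gen_of_ne := fun {𝔭 𝔮} h => by
    change coordP (idxP 𝔮) (genP 𝔭) = 1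
    apply Multiplicative.toAdd.injective
    rw [toAdd_coordP, genP, Pi.mulSingle_eq_of_ne (fun e => h (idxP_injective e)), toAdd_one,
      toAdd_one, NNRat.coe_zero]
  factor_carrier := fun 𝔭 a => by
    refine (PiMonoprime.mem_carrier_iff fac_monoprime 𝔭 a).trans ?_
    change dsupp (a : Φp) = {idxP 𝔭} ↔
      0 < ((Multiplicative.toAdd ((a : Φp) (idxP 𝔭)) : ℚ≥0) : ℚ) ∧
        ∀ 𝔮 : Primes prodTheta.PhiAcirc, 𝔮 ≠ 𝔭 → coordP (idxP 𝔮) a = 1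
    constructor
    · intro hs
      have hi : (a : Φp) (idxP 𝔭) ≠ 1 := by
        have : idxP 𝔭 ∈ dsupp (a : Φp) := by rw [hs]; exact Set.mem_singleton _
        exact this
      refine ⟨?_, fun 𝔮 h𝔮 => ?_⟩
      · have : Multiplicative.toAdd ((a : Φp) (idxP 𝔭)) ≠ 0 := fun h0 => hi (by
          rw [← ofAdd_toAdd ((a : Φp) (idxP 𝔭)), h0, ofAdd_zero])
        exact_mod_cast pos_iff_ne_zero.mpr this
      · have hne : idxP 𝔮 ∉ dsupp (a : Φp) := by
          rw [hs]; exact fun e => h𝔮 (idxP_injective e)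
        have h1 : (a : Φp) (idxP 𝔮) = 1 := by
          by_contra hc; exact hne hc
        apply Multiplicative.toAdd.injective
        rw [toAdd_coordP, h1, toAdd_one, toAdd_one, NNRat.coe_zero]
    · rintro ⟨hpos, hzero⟩
      ext j
      simp only [Set.mem_singleton_iff]
      constructor
      · intro hj
        by_contra hne
        have h𝔮 : Pp j ≠ 𝔭 := fun e => hne (by rw [← e, idxP_Pp])
        have h0 := hzero (Pp j) h𝔮
        rw [idxP_Pp] at h0
        have h0' := congrArg Multiplicative.toAdd h0
        rw [toAdd_coordP, toAdd_one, NNRat.coe_eq_zero] at h0'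
        exact hj (by rw [← ofAdd_toAdd ((a : Φp) j), h0', ofAdd_zero])
      · rintro rfl
        intro h1
        rw [h1, toAdd_one, NNRat.coe_zero] at hpos
        exact lt_irrefl _ hpos
  le_ord_iff := fun 𝔭 a n m hm => by
    change ((n : ℚ) ≤ m * ((Multiplicative.toAdd ((a : Φp) (idxP 𝔭)) : ℚ≥0) : ℚ)) ↔ (genP 𝔭 ^ n ∣ (a : Φp) ^ m)
    rw [genP, PiMonoprime.dvd_iff]
    constructor
    · intro h j
      rw [Pi.pow_apply, Pi.pow_apply]
      by_cases hj : j = idxP 𝔭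
      · subst hj
        rw [Pi.mulSingle_eq_same, mnnrat_dvd_iff, toAdd_pow, toAdd_pow, toAdd_ofAdd, nsmul_eq_mul, mul_one,
          nsmul_eq_mul]
        exact_mod_cast h
      · rw [Pi.mulSingle_eq_of_ne hj, one_pow]; exact one_dvd _
    · intro h
      have hi := h (idxP 𝔭)
      rw [Pi.pow_apply, Pi.pow_apply, Pi.mulSingle_eq_same, mnnrat_dvd_iff, toAdd_pow, toAdd_pow, toAdd_ofAdd,
        nsmul_eq_mul, mul_one, nsmul_eq_mul] at hi
      exact_mod_cast hi
  ncspIso_gen := fun 𝔭 𝔮 _ _ x hx => by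
    have hx' : (x : Φp) = genP 𝔭 := hx
    change ((canonIsoP 𝔭 𝔮 x : ↥𝔮.submonoid) : Φp) = genP 𝔮
    rw [canonIsoP_val, hx', genP, Pi.mulSingle_eq_same, genP]
  cspIso_gen := fun 𝔭 𝔮 _ _ x hx => by
    have hx' : (x : Φp) = genP 𝔭 := hx
    change ((canonIsoP 𝔭 𝔮 x : ↥𝔮.submonoid) : Φp) = genP 𝔮
    rw [canonIsoP_val, hx', genP, Pi.mulSingle_eq_same, genP]
  principal := ⊤
  ordGp_divTheta_cusp := fun 𝔠 h𝔠 => by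
    have hlift : ordGpOf' factorP 𝔠 (Algebra.GrothendieckGroup.of divThetaP) = factorP divThetaP 𝔠 := by
      have h := Algebra.GrothendieckGroup.lift.symm_apply_apply (ordOf' factorP 𝔠)
      rw [Algebra.GrothendieckGroup.lift_symm_apply] at h
      exact DFunLike.congr_fun h divThetaP
    change ordGpOf' factorP 𝔠 (Algebra.GrothendieckGroup.of divThetaP) = _
    rw [hlift]
    obtain ⟨n, hn⟩ := h𝔠
    change coordP (idxP 𝔠) divThetaP = Multiplicative.ofAdd 1
    apply Multiplicative.toAdd.injective
    rw [toAdd_coordP, hn, toAdd_ofAdd]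
    change ((Multiplicative.toAdd (Multiplicative.ofAdd (1 : NNRat)) : ℚ≥0) : ℚ) = 1
    rw [toAdd_ofAdd, NNRat.coe_one]
  exists_translate := fun t => by
    obtain ⟨g, hg⟩ : ∃ g : Aut prodTheta.Acirc, Multiplicative.toAdd g.inv = t := exists_aut_translate t
    have hg' : prodTheta.pullAut g = reindexP (shift t) := MulEquiv.ext fun a => by rw [← hg]; rfl
    have hidx : ∀ 𝔭 : Primes prodTheta.PhiAcirc, idxP (Primes.congr (prodTheta.pullAut g) 𝔭) = shift t (idxP 𝔭) := by
      intro 𝔭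
      rw [hg']
      exact idxP_congr_reindexP (shift t) 𝔭
    refine ⟨g, fun 𝔭 => ?_, fun 𝔭 h𝔭 h𝔭' => ?_⟩
    · change IsCuspP _ ↔ IsCuspP _
      constructor
      · rintro ⟨m, hm⟩
        rw [hidx] at hm
        rcases h : idxP 𝔭 with n | n
        · rw [h] at hm; exact absurd hm Sum.inl_ne_inr
        · exact ⟨n, h⟩
      · rintro ⟨n, hn⟩
        exact ⟨n + t, by rw [hidx, hn]; simp⟩
    · obtain ⟨n, hn⟩ := idxP_eq_inl_of_not_isCuspP h𝔭
      change labelP _ = labelP 𝔭 + t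
      have h1 : idxP (Primes.congr (prodTheta.pullAut g) 𝔭) = Sum.inl (n + t) := by rw [hidx, hn]; simp
      unfold labelP
      rw [h1, hn]
      rfl

/-- The orders of `supportDataQ₀` are the coordinates. [cite: MochizukiEtTh2009, Prop 3.2 (i) p.296 (PDF p.70)] -/
theorem ord₀_of (𝔭 : Primes prodTheta.PhiAcirc) (a : prodTheta.PhiAcirc) :
    supportDataQ₀.ord 𝔭 (Algebra.GrothendieckGroup.of a) = ((Multiplicative.toAdd ((a : Φp) (idxP 𝔭)) : ℚ≥0) : ℚ) := by
  rw [DivisorSupportDataQ.ord_of]; rfl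

/-- In this toy the cusp sum over `𝔫` is the order at the single cusp over `𝔫`, so `degOn` is a four-term combination of
orders. [cite: MochizukiEtTh2009, §1 p.240 (PDF p.14)] -/
theorem degOn₀_eq (𝔫 : {p : Primes prodTheta.PhiAcirc // ¬ prodPrimeData.IsCuspidal p})
    (x : Algebra.GrothendieckGroup prodTheta.PhiAcirc) :
    supportDataQ₀.degOn 𝔫 x =
      supportDataQ₀.ord (ncspShift prodPrimeData (-1) 𝔫).1 x - 2 * supportDataQ₀.ord 𝔫.1 x +
        supportDataQ₀.ord (ncspShift prodPrimeData 1 𝔫).1 x + supportDataQ₀.ord (cuspOver 𝔫).1 x := by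
  rw [DivisorSupportDataQ.degOn, fibre_eq_singleton, finsum_mem_singleton]

/-- `degOn` is additive in this toy (no finiteness needed). [cite: MochizukiEtTh2009, §1 p.240 (PDF p.14)] -/
theorem degOn₀_mul (𝔫 : {p : Primes prodTheta.PhiAcirc // ¬ prodPrimeData.IsCuspidal p})
    (x y : Algebra.GrothendieckGroup prodTheta.PhiAcirc) :
    supportDataQ₀.degOn 𝔫 (x * y) = supportDataQ₀.degOn 𝔫 x + supportDataQ₀.degOn 𝔫 y := by
  simp only [degOn₀_eq, DivisorSupportDataQ.ord_mul]; ring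

/-- `degOn 1 = 0`. [cite: MochizukiEtTh2009, §1 p.240 (PDF p.14)] -/
theorem degOn₀_one (𝔫 : {p : Primes prodTheta.PhiAcirc // ¬ prodPrimeData.IsCuspidal p}) :
    supportDataQ₀.degOn 𝔫 1 = 0 := by
  simp only [degOn₀_eq, DivisorSupportDataQ.ord_one]; ring

/-- `degOn x⁻¹ = − degOn x`. [cite: MochizukiEtTh2009, §1 p.240 (PDF p.14)] -/
theorem degOn₀_inv (𝔫 : {p : Primes prodTheta.PhiAcirc // ¬ prodPrimeData.IsCuspidal p})
    (x : Algebra.GrothendieckGroup prodTheta.PhiAcirc) :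
    supportDataQ₀.degOn 𝔫 x⁻¹ = -supportDataQ₀.degOn 𝔫 x := by
  simp only [degOn₀_eq, DivisorSupportDataQ.ord_inv]; ring

/-- **F1 of the toy: the lattice of integral elements of degree `0` on every component** ("`Pic(𝔜_N) ⥲ ℤ^ℤ` by
degrees", §1 p.240 — the toy's principal divisors).  [cite: MochizukiEtTh2009, §1 p.240 (PDF p.14)] -/
def principalP : Subgroup (Algebra.GrothendieckGroup prodTheta.PhiAcirc) where
  carrier := {x | supportDataQ₀.Integral x ∧ ∀ 𝔫, supportDataQ₀.degOn 𝔫 x = 0}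
  mul_mem' := fun {x y} hx hy => ⟨supportDataQ₀.integral_mul hx.1 hy.1, fun 𝔫 => by
    rw [degOn₀_mul, hx.2 𝔫, hy.2 𝔫, add_zero]⟩
  one_mem' := ⟨supportDataQ₀.integral_one, fun 𝔫 => degOn₀_one 𝔫⟩
  inv_mem' := fun {x} hx => ⟨supportDataQ₀.integral_inv hx.1, fun 𝔫 => by rw [degOn₀_inv, hx.2 𝔫, neg_zero]⟩

/-- **STEP 2: the perfect-`Φ` support data at the product-chain datum**, with F1 the degree-`0` integral lattice.
[cite: MochizukiEtTh2009, Prop 5.3 p.325–326 (PDF pp.99–100); §1 p.240 (PDF p.14)] -/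
def supportDataQ : DivisorSupportDataQ prodPrimeData :=
  { supportDataQ₀ with principal := principalP }

/-- **The binder holds at the toy** (by construction of F1). [cite: MochizukiEtTh2009, §1 p.240 (PDF p.14)] -/
theorem principalIffIntegralDegreeZero_supportDataQ : supportDataQ.PrincipalIffIntegralDegreeZero := by
  intro x
  rw [DivisorSupportDataQ.isPrincipal_iff_mem]
  exact Iff.rfl

/-- **NON-VACUITY of the perfect-`Φ` vocabulary**: at the product-chain datum (perfect `Φ(A_⊚)`) the type
`DivisorSupportDataQ` is inhabited by a datum satisfying `PrincipalIffIntegralDegreeZero`.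
[cite: MochizukiEtTh2009, Prop 5.3 p.325–327 (PDF pp.99–101)] -/
theorem exists_divisorSupportDataQ :
    ∃ 𝔖 : DivisorSupportDataQ prodPrimeData, 𝔖.PrincipalIffIntegralDegreeZero :=
  ⟨supportDataQ, principalIffIntegralDegreeZero_supportDataQ⟩

/-- **… whereas the `ℤ`-reading is EMPTY there** (abc-iut-f-127's certificate applied to this perfect datum).
[cite: MochizukiEtTh2009, Prop 5.1 p.323 (PDF p.97)] -/
theorem isEmpty_divisorSupportData'_prod : IsEmpty (DivisorSupportData' prodPrimeData) :=
  isEmpty_divisorSupportData'_of_isPerfect prodPrimeData isPerfect_phiAcirc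

end Literature.AnabelianGeometry.EtaleTheta.FrobenioidThetaDivisors.QProdChain

end
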